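import Summits.FinalStateConjecture.FinalStateConjecture.Theorems.ProbeNullTraceSegmentToCurve

/-!
# Birth skeleton (BC3) — crux `TameSegmentToCurve` (stmt-FinalStateConjecture-17473), route `ProbeNullTrace`

`Lines/birth.lean` of `Cruxes/TameSegmentToCurve/` (planner-skel-stmt-FinalStateConjecture-17473-0,
skeleton-register one-shot, route re-audit bin REPAIRABLE, 2026-08-17). Target: the route decl
`Summit.FinalStateConjecture.FinalStateConjecture.Theses.ProbeNullTrace.TameSegmentToCurve` BY NAME
(route file rev 5), concluded by `TameSegmentToCurve_of` from two named stubs.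

The crux (rank 9, routine glue of the crux-only deciding theorem `closes`; the TAME upgrade of the
PROVED support `SegmentToCurve`, stmt-9965, `Theorems/ProbeNullTraceSegmentToCurve.lean`): if
`Φ : ℝᵏ → InitialDataSet (𝓡 3) X` is tame on the end `e`, immersed at `0`, injective, with members in
`𝓓`, and the punctured segment `{Φ (t • θ) : 0 < |t| < ε}` (`θ ≠ 0`, `ε > 0`) avoids `𝓔`, then some
one-parameter family `F` is tame ON THE SAME END `e`, immersed at `0`, injective, with `F 0 = Φ 0`,
members in `𝓓`, and `F c ∉ 𝓔` for `c ≠ 0` — the witness `HasTameCodimAtLeastIn 𝓓 𝓔 1` wants at `Φ 0`.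

## The line: reparametrise the punctured segment by the arctan squash

`F := Φ ∘ σ` with the squash `σ(c) = (ε · arctan (c 0) / 2) • θ : ℝ¹ → ℝᵏ` of the proved file
(`Theorems.ProbeNullTrace.arctan_squash_spec`: `σ` smooth, injective for `θ ≠ 0`, `σ 0 = 0`, its
parameter `t(c) = ε · arctan (c 0) / 2` of modulus `< ε` and `≠ 0` for `c ≠ 0`). What the tame crux
adds over the proved `SegmentToCurve` is exactly two transport statements along `σ`, and these are
the two stubs:

* `stub_tame_along_squash` — TAMENESS ON THE SAME END survives the squash: if `Φ` is tame on `e`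
  (`IsTameDataFamily e k Φ`: jointly smooth, `e` sole end, every member DR-flat on `e` with a
  continuous mass, `e.wDist (Φ c) (Φ 0) → 0`), then `c ↦ Φ (σ c)` is tame on `e` as a one-parameter
  family (joint smoothness by precomposition with the smooth `(c, x) ↦ (σ c, x)`; same end, same
  members' asymptotics, mass `M ∘ σ` continuous; `wDist`-continuity at `0` by composing with
  `σ → σ 0 = 0`). No hypothesis on `θ`, `ε` is needed. Size S–M.
* `stub_immersed_along_squash` — IMMERSION AT `0` survives the squash (the crux's "sole subtlety"):
  if `Φ` is immersed at `0` (`IsImmersedAtZero k Φ`, phrased with `fderiv`, junk value `0`), `θ ≠ 0`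
  and `0 < ε`, then `c ↦ Φ (σ c)` is immersed at `0`: `dσ₀ v = (ε · v 0 / 2) • θ` is injective on
  `ℝ¹`, the direction `dσ₀ v ≠ 0` is detected by a scalar component `g = (c ↦ h_c(x)(u,w))` or
  `(c ↦ k_c(x)(u,w))` of `Φ` with `fderiv g 0 (dσ₀ v) ≠ 0`, which FORCES `g` differentiable at `0`
  (else the junk `fderiv` vanishes), and the chain rule gives `fderiv (g ∘ σ) 0 v ≠ 0`. Size S–M.
* `crux_body_of_stub_sigs : <stub₁-sig> → <stub₂-sig> → <body of TameSegmentToCurve>` — REAL PROOF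
  (no sorry of its own): `F := fun c ↦ Φ (σ c)`; tameness and immersion from the stubs; `F 0 = Φ 0`
  from `σ 0 = 0`; injectivity = `Φ` injective ∘ `σ` injective; membership pointwise; avoidance off
  `0` because `σ c = t • θ` with `t ≠ 0`, `|t| < ε` (all from `arctan_squash_spec`); and
  `TameSegmentToCurve_of : TameSegmentToCurve := crux_body_of_stub_sigs stub_tame_along_squash
  stub_immersed_along_squash` concludes the route decl BY NAME (the one theorem the skeleton audit
  keys on; axioms propext / Classical.choice / Quot.sound + the two stubs' `sorryAx`).

Leans on (by name): `Theorems.ProbeNullTrace.arctan_squash_spec`,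
`Theorems.ProbeNullTrace.isSmoothDataFamily_precomp` (proved, this import); for the stub provers:
`Literature.Geometry.Lorentzian.InitialDataSet.IsTameDataFamily.comp_contDiff`
(`Literature/Geometry/Lorentzian/TameGenericityDiagonal.lean`) and
`…IsImmersedAtZero.comp_of_injective_fderiv` (`…/TameGenericityLocal.lean`), neither imported by the
route file. Three grounder candidate proofs of the whole crux are attached to the item (g70-8/9/10,
rc 0, std axioms) — the item is provable now; this skeleton only records the honest two-piece cut.

Both stubs are TRUE as typed: the registrar proved them privately (folder `bc/scratch_stubs_true.lean`,
lean check rc 0, 0 sorries; not published — no proving beyond the assembly in this seat) from the two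
Literature transport lemmas plus `HasFDerivAt σ (((ε/2) • proj 0).smulRight θ) 0`; so neither stub
is costume or misstated, and each is S-sized for a prover with those imports.

Disproof used: none exists (`Cruxes/TameSegmentToCurve/` had no workfiles before this one; no
`Theorems/TameSegmentToCurve/Negative/*`); `ledger negatives --problem FinalStateConjecture` lists one
refuted statement (UniformPhotonSphereChannels, stmt-10045), unrelated to either stub.

BC3 probes (planner folder `bc/probe_stub1.lean`, `bc/probe_stub2.lean`, `bc/probe_literal.lean`;
the first two import the ROUTE FILE only, the third this file's import plus
`TameGenericityDiagonal`/`TameGenericityLocal`; none imports the sorried stubs): for each stub,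
`stub → TameSegmentToCurve` and `stub → FinalStateConjecture` FAIL by the literal
`first | exact? | simpa | aesop` (rc 1: `exact?` could not close the goal, `simpa` assumption failed,
`aesop: failed to prove the goal after exhaustive search`, unsolved `⊢ TameSegmentToCurve` /
`⊢ FinalStateConjecture`) and FAIL alternative-by-alternative for `exact?`, `simpa`, `simpa [C]`,
`(unfold C; simpa)`, `aesop` (20/20 errors, `maxHeartbeats 400000` each, no timeouts) — no stub is
cheaply the crux or the summit.
-/

noncomputable section

-- D-0017: single-problem summit, `Summit.<S>.<S>.…` by design.
set_option linter.dupNamespace false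

open Set Function
open scoped Manifold ContDiff Topology

namespace Summit.FinalStateConjecture.FinalStateConjecture.Cruxes.TameSegmentToCurve.Birth

open Literature.Geometry.Lorentzian

/-! ## §1 The stubs -/

/-- **Stub 1 — tameness on the same end survives the arctan squash.** For a `k`-parameter family
`Φ` of initial data sets on `X`, tame on the end `e`, and any `θ ∈ ℝᵏ`, `ε ∈ ℝ`, the one-parameter
family `c ↦ Φ ((ε · arctan (c 0) / 2) • θ)` is tame on `e`. (Precomposition with a smooth parameter
map fixing `0`: joint smoothness composes, the sole end and the members' Dafermos–Rodnianski
asymptotics are inherited, the mass `M ∘ σ` is continuous, `wDist`-continuity at `0` composes with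
`σ c → 0`.) Christodoulou, Ann. Math. 149 (1999), p. 187 (lines through `α₀` inside a fixed space of
data with fixed asymptotics); cf. `InitialDataSet.IsTameDataFamily.comp_contDiff`. -/
theorem stub_tame_along_squash :
    ∀ (X : Type) [TopologicalSpace X] [ChartedSpace E3 X]
      [IsManifold (𝓡 3) ((⊤ : ℕ∞) : WithTop ℕ∞) X]
      (e : AFEnd X) (k : ℕ) (Φ : EuclideanSpace ℝ (Fin k) → InitialDataSet (𝓡 3) X)
      (θ : EuclideanSpace ℝ (Fin k)) (ε : ℝ),
      InitialDataSet.IsTameDataFamily e k Φ →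
        InitialDataSet.IsTameDataFamily e 1
          (fun c : EuclideanSpace ℝ (Fin 1) ↦ Φ ((ε * Real.arctan (c 0) / 2) • θ)) := by
  sorry

/-- **Stub 2 — immersion at `0` survives the arctan squash.** For a `k`-parameter family `Φ` of
initial data sets on `X` immersed at `0` (`IsImmersedAtZero`, phrased with `fderiv`), `θ ≠ 0` and
`0 < ε`, the one-parameter family `c ↦ Φ ((ε · arctan (c 0) / 2) • θ)` is immersed at `0`: the
differential of the squash at `0`, `v ↦ (ε · v 0 / 2) • θ`, is injective on `ℝ¹`; a scalar component
of `Φ` with non-zero `fderiv` at `0` in the direction `dσ₀ v` is differentiable at `0` (junk value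
`0` otherwise), and the chain rule transports the non-vanishing derivative. Christodoulou, CQG 16
(1999) A23, p. A24 (linear independence of the directions `f₁, …, fₘ`); cf.
`InitialDataSet.IsImmersedAtZero.comp_of_injective_fderiv`. -/
theorem stub_immersed_along_squash :
    ∀ (X : Type) [TopologicalSpace X] [ChartedSpace E3 X]
      [IsManifold (𝓡 3) ((⊤ : ℕ∞) : WithTop ℕ∞) X]
      (k : ℕ) (Φ : EuclideanSpace ℝ (Fin k) → InitialDataSet (𝓡 3) X)
      (θ : EuclideanSpace ℝ (Fin k)) (ε : ℝ),
      InitialDataSet.IsImmersedAtZero k Φ → θ ≠ 0 → 0 < ε →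
        InitialDataSet.IsImmersedAtZero 1
          (fun c : EuclideanSpace ℝ (Fin 1) ↦ Φ ((ε * Real.arctan (c 0) / 2) • θ)) := by
  sorry

/-! ## §2 The composition (kernel-checked, no sorry of its own): stubs 1–2 ⟹ the route decl, by name -/

/-- **The crux body from the two stub signatures** (REAL PROOF, hypotheses = the two stub statements
verbatim, conclusion = the body of `Theses.ProbeNullTrace.TameSegmentToCurve` verbatim).
`F := fun c ↦ Φ (σ c)` with the arctan squash `σ(c) = (ε · arctan (c 0) / 2) • θ` of
`Theorems.ProbeNullTrace.arctan_squash_spec`: tame on `e` by stub 1, immersed at `0` by stub 2,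
`F 0 = Φ 0` as `σ 0 = 0`, injective as `Φ` and `σ` are, members in `𝓓` pointwise, and `F c ∉ 𝓔` for
`c ≠ 0` because `σ c = t • θ` with `t ≠ 0`, `|t| < ε`. (It concludes the BODY, not the name, so that
the skeleton audit sees exactly one theorem concluding the crux by name: `TameSegmentToCurve_of`.) -/
theorem crux_body_of_stub_sigs
    (h₁ : ∀ (X : Type) [TopologicalSpace X] [ChartedSpace E3 X]
      [IsManifold (𝓡 3) ((⊤ : ℕ∞) : WithTop ℕ∞) X]
      (e : AFEnd X) (k : ℕ) (Φ : EuclideanSpace ℝ (Fin k) → InitialDataSet (𝓡 3) X)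
      (θ : EuclideanSpace ℝ (Fin k)) (ε : ℝ),
      InitialDataSet.IsTameDataFamily e k Φ →
        InitialDataSet.IsTameDataFamily e 1
          (fun c : EuclideanSpace ℝ (Fin 1) ↦ Φ ((ε * Real.arctan (c 0) / 2) • θ)))
    (h₂ : ∀ (X : Type) [TopologicalSpace X] [ChartedSpace E3 X]
      [IsManifold (𝓡 3) ((⊤ : ℕ∞) : WithTop ℕ∞) X]
      (k : ℕ) (Φ : EuclideanSpace ℝ (Fin k) → InitialDataSet (𝓡 3) X)
      (θ : EuclideanSpace ℝ (Fin k)) (ε : ℝ),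
      InitialDataSet.IsImmersedAtZero k Φ → θ ≠ 0 → 0 < ε →
        InitialDataSet.IsImmersedAtZero 1
          (fun c : EuclideanSpace ℝ (Fin 1) ↦ Φ ((ε * Real.arctan (c 0) / 2) • θ))) :
    ∀ (X : Type) [TopologicalSpace X] [ChartedSpace Literature.Geometry.Lorentzian.E3 X] [IsManifold (𝓡 3) ((⊤ : ℕ∞) : WithTop ℕ∞) X] (𝓓 𝓔 : Set (Literature.Geometry.Lorentzian.InitialDataSet (𝓡 3) X)) (e : Literature.Geometry.Lorentzian.AFEnd X) (k : ℕ) (Φ : EuclideanSpace ℝ (Fin k) → Literature.Geometry.Lorentzian.InitialDataSet (𝓡 3) X) (θ : EuclideanSpace ℝ (Fin k)) (ε : ℝ), Literature.Geometry.Lorentzian.InitialDataSet.IsTameDataFamily e k Φ → Literature.Geometry.Lorentzian.InitialDataSet.IsImmersedAtZero k Φ → Function.Injective Φ → (∀ c, Φ c ∈ 𝓓) → θ ≠ 0 → 0 < ε → (∀ t : ℝ, t ≠ 0 → |t| < ε → Φ (t • θ) ∉ 𝓔) → ∃ F : EuclideanSpace ℝ (Fin 1) → Literature.Geometry.Lorentzian.InitialDataSet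 (𝓡 3) X, Literature.Geometry.Lorentzian.InitialDataSet.IsTameDataFamily e 1 F ∧ Literature.Geometry.Lorentzian.InitialDataSet.IsImmersedAtZero 1 F ∧ F 0 = Φ 0 ∧ Function.Injective F ∧ (∀ c, F c ∈ 𝓓) ∧ ∀ c, c ≠ 0 → F c ∉ 𝓔 := by
  intro X _ _ _ 𝓓 𝓔 e k Φ θ ε hΦ hΦimm hinj h𝓓 hθ hε hseg
  obtain ⟨-, hσi, hσ0, hσlt, hσne⟩ := Theorems.ProbeNullTrace.arctan_squash_spec hθ hε
  refine ⟨fun c : EuclideanSpace ℝ (Fin 1) ↦ Φ ((ε * Real.arctan (c 0) / 2) • θ),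
    h₁ X e k Φ θ ε hΦ, h₂ X k Φ θ ε hΦimm hθ hε, ?_, ?_, fun c ↦ h𝓓 _, ?_⟩
  · -- base point: `σ 0 = 0`
    show Φ ((ε * Real.arctan ((0 : EuclideanSpace ℝ (Fin 1)) 0) / 2) • θ) = Φ 0
    rw [hσ0]
  · -- injectivity: `Φ` injective, `σ` injective
    intro c c' h
    exact hσi (hinj h)
  · -- avoidance off `0`: `σ c = t • θ`, `t ≠ 0`, `|t| < ε`
    intro c hc
    exact hseg _ (hσne c hc) (hσlt c)

/-- **Skeleton theorem: `TameSegmentToCurve` BY NAME from the two named stubs.** The route decl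
`Theses.ProbeNullTrace.TameSegmentToCurve` is `crux_body_of_stub_sigs` applied to
`stub_tame_along_squash` and `stub_immersed_along_squash` (the def unfolds to its body); its only
sorries are the two stubs it consumes (the audit's `closed` turns true the moment both stubs are
proved in place). -/
theorem TameSegmentToCurve_of :
    Summit.FinalStateConjecture.FinalStateConjecture.Theses.ProbeNullTrace.TameSegmentToCurve :=
  crux_body_of_stub_sigs stub_tame_along_squash stub_immersed_along_squash

end Summit.FinalStateConjecture.FinalStateConjecture.Cruxes.TameSegmentToCurve.Birth

end
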